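import Mathlib
import HarnessLib
import Summits.HubbardSuperconductivity.HubbardSuperconductivity.Theorems.KLProgrammeKLRegimeThinOverlapIncrementTelescopeRegime

/-!
# K3 VL child `KLRegimeVolumeLimitV17F2` (stmt-HubbardSuperconductivity-20440), located item #23 «W2-HALF-VL», THE TRANSFER BUNDLE AT THE TOP FLOW FRAME
# FOR ALL STEPS: `TransferWtData (klTowerTransfer (b·L) M β μ K_n j) … Λ_T C_w` for EVERY `j ≤ n`, ONE constant `C_w` (absolute), no window

Cell `gate-hubbard-kl`, seat p3 (g15), lead of #23.  The dichotomy deep/shallow removed for the assembler of `stub_vl_towerData.hdata`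
(`TowerCrossData.transfer`): at the coarse flow frame `K_n = klFlowFrameU L M β U μ n` (`1 ≤ n ≤ n_β + 1`, history `HistP klPredsV17F2 … 0 n`), for a step
`j = k+1` EITHER the deep window `4ⁿ·U ≤ 4^{2(k+1)+d₀}` holds (p3 g13's door `transferWtData_klTowerTransfer_klEng_flow_deep_vol`) OR (`d₀ ≥ 5`, `U ≤ 1`)
`n > 2(k+1)+5`, and the frame telescope from the base `m₀ := 2(k+1)+5` (inside the window since `4^5·U ≤ 4^{d₀}`) to `n` applies
(`transferWtData_klTowerTransfer_flow_shallow`, W2H-OVL); `j = 0` is the identity transfer.  The only trace of the telescope is the rate condition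
`Λ_T·4ⁿ ≤ ρ_t` (take the spine's rate `Λ j = ΛT j := min (Λ_{n+1}) (ρ_t·4^{−n})`, constant in `j`).

* **`transferWtData_klTowerTransfer_flow_all (d₀) (h : 5 ≤ d₀)`** — `∃ C_w ≥ 1, ρ_t > 0`, the bundle for all `j ≤ n`, `0 ≤ Λ_T ≤ Λ_j`, `Λ_T·4ⁿ ≤ ρ_t`.

No definitions, no sorry.  Nothing asserts any stub, K3, VL or superconductivity. [cite: BenfattoGiulianiMastropietro2006, §2.7 (2.70)–(2.71a), §3 (3.2)–(3.8)]
-/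

noncomputable section

namespace Summit.HubbardSuperconductivity.HubbardSuperconductivity.Theorems.TorusFourierL2

set_option linter.dupNamespace false -- summit = problem name (single-conjunct summit), D-0017

open Set Finset Literature.MathematicalPhysics.QuantumLattice Literature.MathematicalPhysics.QuantumLattice.BandSectorCounting
open Literature.MathematicalPhysics.QuantumLattice.FermiRG Literature.Probability.LatticeModels
open Summit.HubbardSuperconductivity.HubbardSuperconductivity.Theorems.DispersionFlow
open Summit.HubbardSuperconductivity.HubbardSuperconductivity.Theorems.KLRegimeSplit
open Summit.HubbardSuperconductivity.HubbardSuperconductivity.Theorems.KLProgrammeLegKernels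
open Summit.HubbardSuperconductivity.HubbardSuperconductivity.Theorems.PerturbedFermiCurve
open Summit.HubbardSuperconductivity.HubbardSuperconductivity.Theorems.EngineV8
open Summit.HubbardSuperconductivity.HubbardSuperconductivity.Theorems.TwoVolumeSource
open Summit.HubbardSuperconductivity.HubbardSuperconductivity.Theorems.TwoVolumeDefect
open Summit.HubbardSuperconductivity.HubbardSuperconductivity.Theorems.KLRegimeWick
open scoped Real

open Classical

set_option maxHeartbeats 1600000 in -- long binder lists of the two doors
/-- **The transfer bundle at the top flow frame for ALL steps** (see the module docstring).
[cite: BenfattoGiulianiMastropietro2006, §2.7 (2.70)–(2.71a), §3 (3.2)–(3.8)] -/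
theorem transferWtData_klTowerTransfer_flow_all (dd : ℕ) (hdd : 5 ≤ dd) :
    ∃ Cw ρt : ℝ, 1 ≤ Cw ∧ 0 < ρt ∧
      ∀ (G : GeoConsts) (P : SplitConsts) (R : RenConsts) (Qe : EngConsts) (cc : ℝ), R.WF2 → 0 < cc → cc ≤ EngineV8.klEngC₃6 P R →
      ∀ μ ∈ klWindowC, ∀ U : ℝ, 0 < U → U ≤ min (EngineV8.klEngU₀3 P R cc) (1 / (R.Gfr 3 + 1)) →
      ∀ β : ℝ, klBetaMin ≤ β → β ≤ Real.exp (cc / U ^ 2) →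
      ∀ (L M : ℕ) [NeZero L] [NeZero M], EngineV8.klEngL₃ β U ≤ L → EngineV8.klEngM₃ β U L ≤ M →
      ∀ n : ℕ, 1 ≤ n → n ≤ nScales β + 1 → HistP klPredsV17F2 L M G P Qe R β U μ 0 n →
        ∀ (b : ℕ) [NeZero (b * L)], EngineV8.klEngL₃ β U ≤ b * L →
        ∀ j : ℕ, j ≤ n → ∀ ΛT : ℝ, 0 ≤ ΛT → ΛT ≤ klScale klE0 j → ΛT * (4 : ℝ) ^ n ≤ ρt →
          TransferWtData (klTowerTransfer (b * L) M β μ (klFlowFrameU L M β U μ n) j)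
            (klBlockEquivD L b M j) (klBlockEquivD L b M (j - 1)) ΛT Cw := by
  obtain ⟨Cw₁, hCw₁, hdeep⟩ := transferWtData_klTowerTransfer_klEng_flow_deep_vol dd
  obtain ⟨Cw₂, ρt, hCw₂, hρt, hshallow⟩ := transferWtData_klTowerTransfer_flow_shallow dd
  refine ⟨max Cw₁ Cw₂, ρt, hCw₁.trans (le_max_left _ _), hρt, ?_⟩
  intro G P R Qe cc hR2 hcc hcc6 μ hμ U hU hUle β hβmin hβc L M _ _ hL3 hM3 n hn1 hnN hhist b _ hV3 j hjn ΛT hΛT0 hΛTle hΛTρ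
  have hfr : FrameOK R U (nScales β) μ (klFlowFrameU L M β U μ n) := frameOK_klFlowFrameU_of_histP_le hR2 hn1 le_rfl hnN hhist
  have hU1 : U ≤ 1 := ((hUle.trans (min_le_left _ _)).trans (EngineV8.klEngU₀3_le_two_pow P R cc)).trans (by norm_num)
  rcases j with _ | k
  · -- the identity transfer (no window)
    exact transferWtData_mono (hdeep G P R Qe cc hR2 hcc hcc6 μ hμ U hU hUle β hβmin hβc L M hL3 hM3 n hn1 hnN hhist hfr b hV3 0 hjn
      (fun h => absurd h (by norm_num)) ΛT hΛT0 hΛTle) (le_max_left _ _)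
  · by_cases hwin : (4 : ℝ) ^ n * U ≤ (4 : ℝ) ^ (2 * (k + 1) + dd)
    · -- deep: the door at the top frame
      exact transferWtData_mono (hdeep G P R Qe cc hR2 hcc hcc6 μ hμ U hU hUle β hβmin hβc L M hL3 hM3 n hn1 hnN hhist hfr b hV3 (k + 1) hjn
        (fun _ => hwin) ΛT hΛT0 hΛTle) (le_max_left _ _)
    · -- shallow: the frame telescope from the base `m₀ = 2(k+1)+5`
      have hm₀n : 2 * (k + 1) + 5 ≤ n := by
        by_contra hlt
        apply hwin
        have hle : n ≤ 2 * (k + 1) + 5 := by omega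
        calc (4 : ℝ) ^ n * U ≤ (4 : ℝ) ^ n * 1 := mul_le_mul_of_nonneg_left hU1 (by positivity)
          _ ≤ (4 : ℝ) ^ (2 * (k + 1) + 5) := by rw [mul_one]; exact pow_le_pow_right₀ (by norm_num) hle
          _ ≤ (4 : ℝ) ^ (2 * (k + 1) + dd) := pow_le_pow_right₀ (by norm_num) (by omega)
      obtain ⟨d, rfl⟩ : ∃ d, n = 2 * (k + 1) + 5 + d := ⟨n - (2 * (k + 1) + 5), by omega⟩
      have hbase : (4 : ℝ) ^ (2 * (k + 1) + 5) * U ≤ (4 : ℝ) ^ (2 * (k + 1) + dd) :=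
        calc (4 : ℝ) ^ (2 * (k + 1) + 5) * U ≤ (4 : ℝ) ^ (2 * (k + 1) + 5) * 1 := mul_le_mul_of_nonneg_left hU1 (by positivity)
          _ ≤ (4 : ℝ) ^ (2 * (k + 1) + dd) := by rw [mul_one]; exact pow_le_pow_right₀ (by norm_num) (by omega)
      exact transferWtData_mono (hshallow G P R Qe cc hR2 hcc hcc6 μ hμ U hU hUle β hβmin hβc L M hL3 hM3 (2 * (k + 1) + 5) d (by omega) hnN hhist
        b hV3 k le_rfl hbase ΛT hΛT0 hΛTle hΛTρ) (le_max_right _ _)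

end Summit.HubbardSuperconductivity.HubbardSuperconductivity.Theorems.TorusFourierL2

end
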